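import Literature.Geometry.Kaehler.ComplexTorusMumfordTateRankIsogeny
import Literature.Geometry.Kaehler.ComplexTorusPoincareCompleteReducibilityUniqueness
import Literature.Geometry.Kaehler.ComplexTorusPoincareCompleteReducibilityPowers
import Literature.Geometry.Kaehler.ComplexTorusCoordOneForms
import Literature.AlgebraicGeometry.Motives.HodgeStructureDirectSum
import HarnessLib

/-!
# `H¹(∏_k X_k, ℚ) = ⊕_k H¹(X_k, ℚ)` as `ℚ`-Hodge structures, for the dependent finite product torus
# `sigmaPiPeriod`; `dim MT(H¹(∏_k X_k)) = dim MT(⊕_k H¹(X_k))` and `dim MT(H¹(Xⁿ)) = dim MT(H¹(X)^{⊕n})`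

Layer `Literature/Geometry/Kaehler`, namespace `Literature.Geometry.Kaehler.ComplexTorus`; lane `lit-hodgefound`
(Track 2 foundations library; Layer A1 rows A1-21 «`Hᵏ(−, ℚ)` functorial», A1-23 «Mumford–Tate group», A2 products;
the degree-one KÜNNETH formula for the DEPENDENT product `∏_k X_k = ComplexTorus (sigmaPiPeriod Ψ)` of a finite family
of complex tori `X_k = F_k/Ψ_k(ℤ^{σ_k})` of arbitrary dimensions — the binary case `H¹(X₁ × X₂) = H¹(X₁) ⊕ H¹(X₂)` on
`prodPeriod` is the tree's `ComplexTorusRationalHodgeStructureProduct` (`kunnethHom … 1`), not used here).  Definitions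
with bodies (two integer matrices, four morphisms of Hodge structures, one linear equivalence) and theorems; NO named fact
(D-0026 net debt `0`).

THE PRINT.  H. Lange, *Abelian Varieties over the Complex Numbers* (Grundlehren Text Edition, Springer 2023)
[Lange2023AbelianVarietiesComplex], §1.1.2 (products of complex tori, p. 21; the rational representation is additive and
functorial, p. 20), §1.1.3 Lemma 1.1.17 (a) «There is a canonical isomorphism `H¹(X, ℤ) → Hom(Λ, ℤ)`» — for a product
`Λ = ⊕_k Λ_k`, so `H¹(∏_k X_k, ℤ) = ⊕_k Hom(Λ_k, ℤ) = ⊕_k H¹(X_k, ℤ)` — and §1.1.5 Thm. 1.1.21 (b) `H^{1,0}(X) = Hom_ℂ(V, ℂ)`,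
again additive in `V = ⊕_k V_k`; §2.4.4 Thm. 2.4.25 / Cor. 2.4.26 (the products `X₁^{n₁} × ⋯ × X_r^{n_r}`).  C. Voisin,
*Hodge Theory and Complex Algebraic Geometry I* [VoisinHodgeI2002], §7.3.2: pull-backs along holomorphic maps are morphisms
of Hodge structures (tree `ComplexTorus.pullbackHom`); Thm. 11.38 (Künneth) in degree one.  P. Deligne, *Théorie de Hodge
II* [DeligneHodgeII1971], 2.1: direct sums of Hodge structures (tree `HodgeStructure.pi`).  B. B. Gordon
[Gordon1999HodgeAVSurvey] 2.15 (proof) «`W = H_1(A, ℚ) ≃ ⊕_{i=1}^r H_1(A_i, ℚ)`» for `A = A₁ × ⋯ × A_r`, and Prop. 2.4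
(the Mumford–Tate group acts diagonally on powers).

WHAT IS PROVED (`Ψ : ∀ k, (σ k → ℝ) ≃L[ℝ] F k` a finite family of period isomorphisms, `T = sigmaPiPeriod Ψ` the product
torus `∏_k X_k`, every degree `n` unless said otherwise):
* §1 `sigmaProjMatrix Ψ k`, `sigmaInclMatrix Ψ k` — the integer matrices (rational representations) of the projection
  `π_k : ∏_j X_j → X_k` and of the inclusion `s_k : X_k → ∏_j X_j`; their analytic representations are the `ℂ`-linear
  `w ↦ w k` and `u ↦ (0, …, u, …, 0)` (`realRep_sigmaProjMatrix`, `realRep_sigmaInclMatrix`).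
* §2 `sigmaPiProjHom Ψ k n = π_k^* : Hⁿ(X_k, ℚ) → Hⁿ(∏ X, ℚ)` and `sigmaPiInclHom Ψ k n = s_k^*`, morphisms of Hodge
  structures (the tree's `pullbackHom`); `sigmaPiFormsOfPi Ψ n = Σ_k π_k^* : ⊕_k Hⁿ(X_k) → Hⁿ(∏ X)` (`Hom.piDesc`) and
  `sigmaPiFormsToPi Ψ n = (s_k^*)_k : Hⁿ(∏ X) → ⊕_k Hⁿ(X_k)`, morphisms of Hodge structures in every degree.
* §3 degree one: `s_k^* π_k^* = id`, `s_j^* π_k^* = 0` (`j ≠ k`), and `Σ_k π_k^* s_k^* = id` on `H¹(∏ X, ℚ)` (a one-form on a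
  product is the sum of its restrictions to the factors); hence the linear EQUIVALENCE
  **`sigmaPiFormsEquiv Ψ : H¹(∏_k X_k, ℚ) ≃ₗ[ℚ] ⊕_k H¹(X_k, ℚ)`** both of whose directions are morphisms of Hodge structures,
  and the EQUALITY **`pi_hodgeStructure_one_comapEquiv_eq`**:
  `(HodgeStructure.pi fun k ↦ hodgeStructure (Ψ k) 1).comapEquiv (sigmaPiFormsEquiv Ψ) = hodgeStructure (sigmaPiPeriod Ψ) 1`
  — **`H¹(∏_k X_k, ℚ) = ⊕_k H¹(X_k, ℚ)` as `ℚ`-Hodge structures of weight one**.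
* §4 (universe-`0` carriers, the tree's `HodgeTensorFacts.{0,0}` convention; finite-dimensionality as instance arguments)
  **`mtRank_hodgeStructure_sigmaPiPeriod_one`** — `dim MT(H¹(∏_k X_k, ℚ)) = dim MT(⊕_k H¹(X_k, ℚ))`; for the powers
  `Xⁿ = ComplexTorus (powPeriod Φ n)` (`≅ ∏_{j<n} X`, tree `isIsomorphic_powPeriod_sigmaPiPeriod_const`, and row g10-#1's
  `IsIsomorphic.mtRank_hodgeStructure_eq`) **`mtRank_hodgeStructure_powPeriod_one`** —
  `dim MT(H¹(Xⁿ, ℚ)) = dim MT(⊕_{j<n} H¹(X, ℚ))`; `isPolarizable_hodgeStructure_sigmaPiPeriod_one` (⊕ of polarisable is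
  polarisable).

## References
* [Lange2023AbelianVarietiesComplex] H. Lange (2023) — §1.1.2 (pp. 19–21), §1.1.3 Lemma 1.1.17 (a), §1.1.5 Thm. 1.1.21 (b),
  §2.4.4 Thm. 2.4.25 / Cor. 2.4.26.
* [VoisinHodgeI2002] C. Voisin (2002) — §7.3.2 (PDF pp. 149–150), Thm. 11.38.
* [DeligneHodgeII1971] P. Deligne (1971) — 2.1.
* [Gordon1999HodgeAVSurvey] B. B. Gordon (1999) — 2.15 (proof), Prop. 2.4, 2.1.7.

## Provenance
Lane `lit-hodgefound`, prover seat `lit-hodgefound-p29` (generation 10), row g10-#2 FILE 1; consumes BY NAME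
`ComplexTorusRationalHodgeStructurePullback` (`pullbackHom`, `pullbackForms`, `coe_pullbackForms_apply`, `realRep_apply`),
`ComplexTorusPoincareCompleteReducibilityIsogeny/…Powers/…Uniqueness` (`sigmaPiPeriod`, `sigmaPiPeriod_apply`,
`sigmaPiPeriod_symm_apply`, `isIsomorphic_powPeriod_sigmaPiPeriod_const`), `ComplexTorusCoordOneForms` (`apply_eq_apply_const`),
`ComplexTorusHolomorphicOneForms` (`oneForm`), `Motives/HodgeStructureDirectSum` (`HodgeStructure.pi`, `mem_pi_F_iff`,
`proj_baseChange_apply`, `Hom.piDesc`, `IsPolarizable.pi`), row g10-#1 FILE 1 `ComplexTorusMumfordTateRankIsogeny`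
(`IsIsomorphic.mtRank_hodgeStructure_eq`, `IsIsogenous.isPolarizable_hodgeStructure_iff`), `Motives/MumfordTateRankInvariance`
(`mtRank_comapEquiv`), `Motives/GeometricVHSPolarizedTransport` (`comapEquiv`, `IsPolarizable.comapEquiv`).
-/

noncomputable section

set_option maxSynthPendingDepth 3

open Module
open scoped Matrix

namespace Literature.Geometry.Kaehler

namespace ComplexTorus

open Literature.AlgebraicGeometry.Motives (HodgeStructure)
open Literature.AlgebraicGeometry.Motives.HodgeStructure (Hom comapEquiv)

section SigmaPi

variable {κ : Type*} [Fintype κ] [DecidableEq κ] {σ : κ → Type*} [∀ k, Fintype (σ k)] [∀ k, DecidableEq (σ k)]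
  {F : κ → Type*} [∀ k, NormedAddCommGroup (F k)] [∀ k, NormedSpace ℂ (F k)]
  (Ψ : ∀ k, (σ k → ℝ) ≃L[ℝ] F k)

/-! ## §1 The projections `π_k` and inclusions `s_k` of the product torus as integer matrices -/

/-- The rational (indeed integral) representation of the projection `π_k : ∏_j X_j → X_k`: the `0/1` matrix
`Λ_∏ = ⊕_j ℤ^{σ_j} → ℤ^{σ_k}` picking the `k`-th block. [cite: Lange2023AbelianVarietiesComplex, §1.1.2 (p. 20) and §2.4.4 Cor. 2.4.26 (proof)] -/
def sigmaProjMatrix (k : κ) : Matrix (σ k) (Σ j, σ j) ℤ :=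
  Matrix.of fun i q => if q = ⟨k, i⟩ then 1 else 0

/-- The rational (integral) representation of the inclusion `s_k : X_k → ∏_j X_j` of the `k`-th factor: the transpose
`0/1` matrix `ℤ^{σ_k} → ⊕_j ℤ^{σ_j}`. [cite: Lange2023AbelianVarietiesComplex, §1.1.2 (p. 20) and §2.4.4 Cor. 2.4.26 (proof)] -/
def sigmaInclMatrix (k : κ) : Matrix (Σ j, σ j) (σ k) ℤ :=
  Matrix.of fun q i => if q = ⟨k, i⟩ then 1 else 0

/-- `(π_k)_ℝ v = v(k, ·)`. [cite: Lange2023AbelianVarietiesComplex, §1.1.2 (p. 20)] -/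
theorem sigmaProjMatrix_mulVec (k : κ) (v : (Σ j, σ j) → ℝ) (i : σ k) :
    ((sigmaProjMatrix (σ := σ) k).map (Int.cast : ℤ → ℝ) *ᵥ v) i = v ⟨k, i⟩ := by
  simp [Matrix.mulVec, dotProduct, sigmaProjMatrix, Int.cast_ite, ite_mul]

omit [Fintype κ] in
/-- `(s_k)_ℝ x` at the slot `(k, i)` is `x i`. [cite: Lange2023AbelianVarietiesComplex, §1.1.2 (p. 20)] -/
theorem sigmaInclMatrix_mulVec_same (k : κ) (x : σ k → ℝ) (i : σ k) :
    ((sigmaInclMatrix (σ := σ) k).map (Int.cast : ℤ → ℝ) *ᵥ x) ⟨k, i⟩ = x i := by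
  simp [Matrix.mulVec, dotProduct, sigmaInclMatrix, Int.cast_ite, ite_mul]

omit [Fintype κ] in
/-- `(s_k)_ℝ x` vanishes off the `k`-th block. [cite: Lange2023AbelianVarietiesComplex, §1.1.2 (p. 20)] -/
theorem sigmaInclMatrix_mulVec_of_ne (k : κ) (x : σ k → ℝ) (q : Σ j, σ j) (hq : q.1 ≠ k) :
    ((sigmaInclMatrix (σ := σ) k).map (Int.cast : ℤ → ℝ) *ᵥ x) q = 0 := by
  have hne : ∀ i : σ k, q ≠ ⟨k, i⟩ := fun i h => hq (by rw [h])
  simp only [Matrix.mulVec, dotProduct, Matrix.map_apply, sigmaInclMatrix, Matrix.of_apply, hne, if_false,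
    Int.cast_zero, zero_mul, Finset.sum_const_zero]

/-- `T((s_k)_ℝ x) = (0, …, Ψ_k x, …, 0)`: the inclusion of the `k`-th factor on universal covers.
[cite: Lange2023AbelianVarietiesComplex, §1.1.2 (p. 21, products)] -/
theorem sigmaPiPeriod_sigmaInclMatrix_mulVec (k : κ) (x : σ k → ℝ) :
    sigmaPiPeriod Ψ ((sigmaInclMatrix (σ := σ) k).map (Int.cast : ℤ → ℝ) *ᵥ x) = Pi.single k (Ψ k x) := by
  funext j
  rw [sigmaPiPeriod_apply]
  by_cases hj : j = k
  · subst hj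
    rw [Pi.single_eq_same]
    congr 1
    funext i
    exact sigmaInclMatrix_mulVec_same _ x i
  · rw [Pi.single_eq_of_ne hj]
    have h0 : (fun i : σ j => ((sigmaInclMatrix (σ := σ) k).map (Int.cast : ℤ → ℝ) *ᵥ x) ⟨j, i⟩) = 0 :=
      funext fun i => sigmaInclMatrix_mulVec_of_ne k x ⟨j, i⟩ hj
    rw [h0, map_zero]

/-- **The analytic representation of the projection `π_k` is `w ↦ w k`.**
[cite: Lange2023AbelianVarietiesComplex, §1.1.2 Prop. 1.1.6 and p. 21] -/
theorem realRep_sigmaProjMatrix (k : κ) (w : ∀ j, F j) :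
    realRep (sigmaPiPeriod Ψ) (Ψ k) (sigmaProjMatrix (σ := σ) k) w = w k := by
  obtain ⟨v, rfl⟩ := (sigmaPiPeriod Ψ).surjective w
  rw [realRep_apply, sigmaPiPeriod_apply]
  congr 1
  funext i
  exact sigmaProjMatrix_mulVec k v i

/-- **The analytic representation of the inclusion `s_k` is `u ↦ (0, …, u, …, 0)`.**
[cite: Lange2023AbelianVarietiesComplex, §1.1.2 Prop. 1.1.6 and p. 21] -/
theorem realRep_sigmaInclMatrix (k : κ) (u : F k) :
    realRep (Ψ k) (sigmaPiPeriod Ψ) (sigmaInclMatrix (σ := σ) k) u = Pi.single k u := by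
  obtain ⟨x, rfl⟩ := (Ψ k).surjective u
  rw [realRep_apply, sigmaPiPeriod_sigmaInclMatrix_mulVec]

/-- `π_k` is a homomorphism of complex tori: its analytic representation is `ℂ`-linear.
[cite: Lange2023AbelianVarietiesComplex, §1.1.2 Prop. 1.1.6] -/
theorem realRep_sigmaProjMatrix_smul (k : κ) (c : ℂ) (w : ∀ j, F j) :
    realRep (sigmaPiPeriod Ψ) (Ψ k) (sigmaProjMatrix (σ := σ) k) (c • w) =
      c • realRep (sigmaPiPeriod Ψ) (Ψ k) (sigmaProjMatrix (σ := σ) k) w := by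
  rw [realRep_sigmaProjMatrix, realRep_sigmaProjMatrix, Pi.smul_apply]

/-- `s_k` is a homomorphism of complex tori: its analytic representation is `ℂ`-linear.
[cite: Lange2023AbelianVarietiesComplex, §1.1.2 Prop. 1.1.6] -/
theorem realRep_sigmaInclMatrix_smul (k : κ) (c : ℂ) (u : F k) :
    realRep (Ψ k) (sigmaPiPeriod Ψ) (sigmaInclMatrix (σ := σ) k) (c • u) =
      c • realRep (Ψ k) (sigmaPiPeriod Ψ) (sigmaInclMatrix (σ := σ) k) u := by
  rw [realRep_sigmaInclMatrix, realRep_sigmaInclMatrix, Pi.single_smul]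

/-! ## §2 The pull-backs `π_k^*`, `s_k^*` and the comparison morphisms `Hⁿ(∏ X) ⇄ ⊕_k Hⁿ(X_k)` -/

/-- **`π_k^* : Hⁿ(X_k, ℚ) → Hⁿ(∏_j X_j, ℚ)`**, a morphism of `ℚ`-Hodge structures (pull-back along the holomorphic
projection). [cite: VoisinHodgeI2002, §7.3.2 (PDF p. 150)] [cite: Lange2023AbelianVarietiesComplex, §1.1.2 (p. 20)] -/
def sigmaPiProjHom (k : κ) (n : ℕ) : Hom (hodgeStructure (Ψ k) n) (hodgeStructure (sigmaPiPeriod Ψ) n) :=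
  pullbackHom (sigmaPiPeriod Ψ) (Ψ k) (sigmaProjMatrix (σ := σ) k) (realRep_sigmaProjMatrix_smul Ψ k) n

/-- **`s_k^* : Hⁿ(∏_j X_j, ℚ) → Hⁿ(X_k, ℚ)`**, a morphism of `ℚ`-Hodge structures (pull-back along the holomorphic
inclusion of the `k`-th factor). [cite: VoisinHodgeI2002, §7.3.2 (PDF p. 150)] [cite: Lange2023AbelianVarietiesComplex, §1.1.2 (p. 20)] -/
def sigmaPiInclHom (k : κ) (n : ℕ) : Hom (hodgeStructure (sigmaPiPeriod Ψ) n) (hodgeStructure (Ψ k) n) :=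
  pullbackHom (Ψ k) (sigmaPiPeriod Ψ) (sigmaInclMatrix (σ := σ) k) (realRep_sigmaInclMatrix_smul Ψ k) n

/-- `π_k^* γ = γ ∘ (w ↦ w k)` on forms. [cite: VoisinHodgeI2002, §7.3.2 (PDF p. 149)] -/
theorem coe_sigmaPiProjHom_apply (k : κ) (n : ℕ) (γ : rationalForms (Ψ k) n) :
    ((sigmaPiProjHom Ψ k n).toLinearMap γ : (∀ j, F j) [⋀^Fin n]→L[ℝ] ℂ) =
      (γ : F k [⋀^Fin n]→L[ℝ] ℂ).compContinuousLinearMap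
        (realRep (sigmaPiPeriod Ψ) (Ψ k) (sigmaProjMatrix (σ := σ) k)) :=
  rfl

/-- `s_k^* γ = γ ∘ (u ↦ (0, …, u, …, 0))` on forms. [cite: VoisinHodgeI2002, §7.3.2 (PDF p. 149)] -/
theorem coe_sigmaPiInclHom_apply (k : κ) (n : ℕ) (γ : rationalForms (sigmaPiPeriod Ψ) n) :
    ((sigmaPiInclHom Ψ k n).toLinearMap γ : F k [⋀^Fin n]→L[ℝ] ℂ) =
      (γ : (∀ j, F j) [⋀^Fin n]→L[ℝ] ℂ).compContinuousLinearMap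
        (realRep (Ψ k) (sigmaPiPeriod Ψ) (sigmaInclMatrix (σ := σ) k)) :=
  rfl

/-- **`Σ_k π_k^* : ⊕_k Hⁿ(X_k, ℚ) → Hⁿ(∏_k X_k, ℚ)`**, a morphism of Hodge structures out of the direct sum
(`Hom.piDesc`). [cite: DeligneHodgeII1971, 2.1] [cite: VoisinHodgeI2002, §7.3.2] -/
def sigmaPiFormsOfPi (n : ℕ) :
    Hom (HodgeStructure.pi fun k => hodgeStructure (Ψ k) n) (hodgeStructure (sigmaPiPeriod Ψ) n) :=
  Hom.piDesc fun k => sigmaPiProjHom Ψ k n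

/-- **`(s_k^*)_k : Hⁿ(∏_k X_k, ℚ) → ⊕_k Hⁿ(X_k, ℚ)`**, a morphism of Hodge structures into the direct sum (the
filtration of the direct sum is componentwise, `HodgeStructure.mem_pi_F_iff`). [cite: DeligneHodgeII1971, 2.1]
[cite: VoisinHodgeI2002, §7.3.2] -/
def sigmaPiFormsToPi (n : ℕ) :
    Hom (hodgeStructure (sigmaPiPeriod Ψ) n) (HodgeStructure.pi fun k => hodgeStructure (Ψ k) n) where
  toLinearMap := LinearMap.pi fun k => (sigmaPiInclHom Ψ k n).toLinearMap
  map_F_le p := by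
    rintro _ ⟨x, hx, rfl⟩
    rw [HodgeStructure.mem_pi_F_iff]
    intro k
    rw [← HodgeStructure.proj_baseChange_apply, ← LinearMap.comp_apply, ← LinearMap.baseChange_comp,
      LinearMap.proj_pi]
    exact (sigmaPiInclHom Ψ k n).map_F_le p ⟨x, hx, rfl⟩

/-- `sigmaPiFormsOfPi (γ_k)_k = Σ_k π_k^* γ_k`. [cite: DeligneHodgeII1971, 2.1] -/
theorem sigmaPiFormsOfPi_apply (n : ℕ) (v : ∀ k, rationalForms (Ψ k) n) :
    (sigmaPiFormsOfPi Ψ n).toLinearMap v = ∑ k, (sigmaPiProjHom Ψ k n).toLinearMap (v k) :=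
  Hom.piDesc_apply _ v

/-- `(sigmaPiFormsToPi γ) k = s_k^* γ`. [cite: DeligneHodgeII1971, 2.1] -/
theorem sigmaPiFormsToPi_apply (n : ℕ) (γ : rationalForms (sigmaPiPeriod Ψ) n) (k : κ) :
    (sigmaPiFormsToPi Ψ n).toLinearMap γ k = (sigmaPiInclHom Ψ k n).toLinearMap γ :=
  rfl

/-! ## §3 Degree one: `s_k^* π_k^* = id`, `s_j^* π_k^* = 0`, `Σ_k π_k^* s_k^* = id`; the equivalence and the equality -/

/-- `s_k^* π_k^* = id` on `H¹(X_k, ℚ)` (`π_k ∘ s_k = id_{X_k}`). [cite: Lange2023AbelianVarietiesComplex, §1.1.2 (p. 20)] -/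
theorem sigmaPiInclHom_sigmaPiProjHom_apply_same (k : κ) (γ : rationalForms (Ψ k) 1) :
    (sigmaPiInclHom Ψ k 1).toLinearMap ((sigmaPiProjHom Ψ k 1).toLinearMap γ) = γ := by
  apply Subtype.ext
  rw [coe_sigmaPiInclHom_apply, coe_sigmaPiProjHom_apply]
  ext v
  rw [ContinuousAlternatingMap.compContinuousLinearMap_apply, ContinuousAlternatingMap.compContinuousLinearMap_apply]
  congr 1
  funext i
  simp only [Function.comp_apply, realRep_sigmaInclMatrix, realRep_sigmaProjMatrix, Pi.single_eq_same]

/-- `s_j^* π_k^* = 0` on one-forms for `j ≠ k` (`π_k ∘ s_j = 0`). [cite: Lange2023AbelianVarietiesComplex, §1.1.2 (p. 20)] -/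
theorem sigmaPiInclHom_sigmaPiProjHom_apply_of_ne {j k : κ} (hjk : j ≠ k) (γ : rationalForms (Ψ k) 1) :
    (sigmaPiInclHom Ψ j 1).toLinearMap ((sigmaPiProjHom Ψ k 1).toLinearMap γ) = 0 := by
  apply Subtype.ext
  rw [coe_sigmaPiInclHom_apply, coe_sigmaPiProjHom_apply, Submodule.coe_zero]
  ext v
  rw [ContinuousAlternatingMap.compContinuousLinearMap_apply, ContinuousAlternatingMap.compContinuousLinearMap_apply,
    ContinuousAlternatingMap.coe_zero, Pi.zero_apply]
  have h0 : (realRep (sigmaPiPeriod Ψ) (Ψ k) (sigmaProjMatrix (σ := σ) k) ∘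
      (realRep (Ψ j) (sigmaPiPeriod Ψ) (sigmaInclMatrix (σ := σ) j) ∘ v)) = 0 := by
    funext i
    simp only [Function.comp_apply, realRep_sigmaInclMatrix, realRep_sigmaProjMatrix, Pi.single_eq_of_ne (Ne.symm hjk),
      Pi.zero_apply]
  rw [h0]
  exact (γ : F k [⋀^Fin 1]→L[ℝ] ℂ).map_zero

/-- **A one-form on a product is the sum of its restrictions to the factors: `Σ_k π_k^* s_k^* = id` on
`H¹(∏_k X_k, ℚ)`** (`v = Σ_k s_k(π_k v)` and a one-form is linear in its argument).
[cite: Lange2023AbelianVarietiesComplex, §1.1.3 Lemma 1.1.17 (a) and §1.1.2 (p. 21)] -/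
theorem sum_sigmaPiProjHom_sigmaPiInclHom_apply (γ : rationalForms (sigmaPiPeriod Ψ) 1) :
    ∑ k, (sigmaPiProjHom Ψ k 1).toLinearMap ((sigmaPiInclHom Ψ k 1).toLinearMap γ) = γ := by
  apply Subtype.ext
  rw [Submodule.coe_sum]
  ext v
  rw [ContinuousAlternatingMap.sum_apply]
  simp only [coe_sigmaPiProjHom_apply, coe_sigmaPiInclHom_apply, ContinuousAlternatingMap.compContinuousLinearMap_apply]
  -- each summand is `γ` at the constant tuple `(0, …, (v 0) k, …, 0)`
  have hk : ∀ k, (γ : (∀ j, F j) [⋀^Fin 1]→L[ℝ] ℂ)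
      (realRep (Ψ k) (sigmaPiPeriod Ψ) (sigmaInclMatrix (σ := σ) k) ∘
        (realRep (sigmaPiPeriod Ψ) (Ψ k) (sigmaProjMatrix (σ := σ) k) ∘ v)) =
      oneForm.symm (γ : (∀ j, F j) [⋀^Fin 1]→L[ℝ] ℂ) (Pi.single k (v 0 k)) := by
    intro k
    rw [oneForm_symm_apply]
    refine (apply_eq_apply_const _ _).trans ?_
    congr 1
    funext i
    simp only [Function.comp_apply, realRep_sigmaProjMatrix, realRep_sigmaInclMatrix]
  simp only [hk]
  rw [← map_sum, Finset.univ_sum_single, oneForm_symm_apply, ← apply_eq_apply_const]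

/-- `toPi (ofPi v) = v`: `s_j^*(Σ_k π_k^* γ_k) = γ_j`. [cite: Lange2023AbelianVarietiesComplex, §1.1.3 Lemma 1.1.17 (a)] -/
theorem sigmaPiFormsToPi_sigmaPiFormsOfPi_apply (v : ∀ k, rationalForms (Ψ k) 1) :
    (sigmaPiFormsToPi Ψ 1).toLinearMap ((sigmaPiFormsOfPi Ψ 1).toLinearMap v) = v := by
  funext j
  rw [sigmaPiFormsToPi_apply, sigmaPiFormsOfPi_apply, map_sum,
    Finset.sum_eq_single j (fun k _ hkj => sigmaPiInclHom_sigmaPiProjHom_apply_of_ne Ψ (Ne.symm hkj) (v k))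
      (fun h => (h (Finset.mem_univ j)).elim),
    sigmaPiInclHom_sigmaPiProjHom_apply_same]

/-- `ofPi (toPi γ) = γ`: `Σ_k π_k^* s_k^* γ = γ`. [cite: Lange2023AbelianVarietiesComplex, §1.1.3 Lemma 1.1.17 (a)] -/
theorem sigmaPiFormsOfPi_sigmaPiFormsToPi_apply (γ : rationalForms (sigmaPiPeriod Ψ) 1) :
    (sigmaPiFormsOfPi Ψ 1).toLinearMap ((sigmaPiFormsToPi Ψ 1).toLinearMap γ) = γ := by
  rw [sigmaPiFormsOfPi_apply]
  exact sum_sigmaPiProjHom_sigmaPiInclHom_apply Ψ γ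

/-- **`H¹(∏_k X_k, ℚ) ≃ ⊕_k H¹(X_k, ℚ)`** as `ℚ`-vector spaces, `γ ↦ (s_k^* γ)_k` with inverse `(γ_k)_k ↦ Σ_k π_k^* γ_k`
— «`H¹(X, ℤ) = Hom(Λ, ℤ)`» for `Λ = ⊕_k Λ_k`. [cite: Lange2023AbelianVarietiesComplex, §1.1.3 Lemma 1.1.17 (a) and §1.1.2 (p. 21)]
[cite: Gordon1999HodgeAVSurvey, 2.15 (proof)] -/
def sigmaPiFormsEquiv : rationalForms (sigmaPiPeriod Ψ) 1 ≃ₗ[ℚ] ∀ k, rationalForms (Ψ k) 1 :=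
  { (sigmaPiFormsToPi Ψ 1).toLinearMap with
    invFun := (sigmaPiFormsOfPi Ψ 1).toLinearMap
    left_inv := sigmaPiFormsOfPi_sigmaPiFormsToPi_apply Ψ
    right_inv := sigmaPiFormsToPi_sigmaPiFormsOfPi_apply Ψ }

/-- The underlying linear map of `sigmaPiFormsEquiv` is that of the morphism `sigmaPiFormsToPi`.
[cite: Lange2023AbelianVarietiesComplex, §1.1.3 Lemma 1.1.17 (a)] -/
theorem sigmaPiFormsEquiv_toLinearMap :
    (sigmaPiFormsEquiv Ψ).toLinearMap = (sigmaPiFormsToPi Ψ 1).toLinearMap :=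
  rfl

/-- `sigmaPiFormsEquiv γ k = s_k^* γ`. [cite: Lange2023AbelianVarietiesComplex, §1.1.3 Lemma 1.1.17 (a)] -/
theorem sigmaPiFormsEquiv_apply (γ : rationalForms (sigmaPiPeriod Ψ) 1) (k : κ) :
    sigmaPiFormsEquiv Ψ γ k = (sigmaPiInclHom Ψ k 1).toLinearMap γ :=
  rfl

/-- `(sigmaPiFormsEquiv)⁻¹ (γ_k)_k = Σ_k π_k^* γ_k`. [cite: Lange2023AbelianVarietiesComplex, §1.1.3 Lemma 1.1.17 (a)] -/
theorem sigmaPiFormsEquiv_symm_apply (v : ∀ k, rationalForms (Ψ k) 1) :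
    (sigmaPiFormsEquiv Ψ).symm v = ∑ k, (sigmaPiProjHom Ψ k 1).toLinearMap (v k) :=
  sigmaPiFormsOfPi_apply Ψ 1 v

/-- If `g ∘ f = id` for morphisms of Hodge structures `f : H₁ → H₂`, `g : H₂ → H₁`, then `f_ℂ⁻¹(Fᵖ H₂) = Fᵖ H₁`
(file-local form of the strictness of isomorphisms, as in `ComplexMultiplication/CMTorusCohomologyOfCMType`). [folklore] -/
private theorem comap_baseChange_F_eq_of_leftInverse' {V W : Type*} [AddCommGroup V] [Module ℚ V]
    [AddCommGroup W] [Module ℚ W] {n : ℤ} {H₁ : HodgeStructure V n} {H₂ : HodgeStructure W n} (f : Hom H₁ H₂)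
    (g : Hom H₂ H₁) (hgf : ∀ v, g.toLinearMap (f.toLinearMap v) = v) (p : ℤ) :
    (H₂.F p).comap (f.toLinearMap.baseChange ℂ) = H₁.F p := by
  refine le_antisymm (fun x hx => ?_) (fun x hx => f.map_F_le p ⟨x, hx, rfl⟩)
  have hcomp : g.toLinearMap ∘ₗ f.toLinearMap = LinearMap.id := LinearMap.ext hgf
  have hx' : x = g.toLinearMap.baseChange ℂ (f.toLinearMap.baseChange ℂ x) := by
    rw [← LinearMap.comp_apply, ← LinearMap.baseChange_comp, hcomp, LinearMap.baseChange_id, LinearMap.id_apply]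
  rw [hx']
  exact g.map_F_le p ⟨_, hx, rfl⟩

/-- **The Hodge filtrations correspond**: `(toPi ⊗ ℂ)⁻¹ (Fᵖ ⊕_k H¹(X_k)) = Fᵖ H¹(∏_k X_k)` for every `p`.
[cite: Lange2023AbelianVarietiesComplex, §1.1.5 Thm. 1.1.21 (b)] [cite: DeligneHodgeII1971, 2.1] -/
theorem comap_baseChange_sigmaPiFormsEquiv_F (p : ℤ) :
    ((HodgeStructure.pi fun k => hodgeStructure (Ψ k) 1).F p).comap ((sigmaPiFormsEquiv Ψ).toLinearMap.baseChange ℂ) =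
      (hodgeStructure (sigmaPiPeriod Ψ) 1).F p := by
  rw [sigmaPiFormsEquiv_toLinearMap]
  exact comap_baseChange_F_eq_of_leftInverse' (sigmaPiFormsToPi Ψ 1) (sigmaPiFormsOfPi Ψ 1)
    (sigmaPiFormsOfPi_sigmaPiFormsToPi_apply Ψ) p

/-- **KÜNNETH IN DEGREE ONE FOR THE PRODUCT TORUS: `H¹(∏_k X_k, ℚ) = ⊕_k H¹(X_k, ℚ)` as `ℚ`-Hodge structures** —
the transport of the direct sum `⊕_k H¹(X_k, ℚ)` (`HodgeStructure.pi`) along `sigmaPiFormsEquiv` IS the Hodge structure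
`H¹(∏_k X_k, ℚ)` of the product torus `ComplexTorus (sigmaPiPeriod Ψ)` («`H¹(X, ℤ) = Hom(Λ, ℤ)`», `H^{1,0} = Hom_ℂ(V, ℂ)`,
both additive in the factors). [cite: Lange2023AbelianVarietiesComplex, §1.1.3 Lemma 1.1.17 (a) and §1.1.5 Thm. 1.1.21 (b)]
[cite: VoisinHodgeI2002, Thm. 11.38] [cite: DeligneHodgeII1971, 2.1] -/
theorem pi_hodgeStructure_one_comapEquiv_eq :
    (HodgeStructure.pi fun k => hodgeStructure (Ψ k) 1).comapEquiv (sigmaPiFormsEquiv Ψ) =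
      hodgeStructure (sigmaPiPeriod Ψ) 1 := by
  ext p x
  rw [HodgeStructure.comapEquiv_F, comap_baseChange_sigmaPiFormsEquiv_F]

/-- The same read from the direct sum: `⊕_k H¹(X_k, ℚ)` is the transport of `H¹(∏_k X_k, ℚ)` along `sigmaPiFormsEquiv⁻¹`.
[cite: Lange2023AbelianVarietiesComplex, §1.1.3 Lemma 1.1.17 (a)] [cite: DeligneHodgeII1971, 2.1] -/
theorem hodgeStructure_one_comapEquiv_symm_eq :
    (hodgeStructure (sigmaPiPeriod Ψ) 1).comapEquiv (sigmaPiFormsEquiv Ψ).symm =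
      HodgeStructure.pi fun k => hodgeStructure (Ψ k) 1 := by
  rw [← pi_hodgeStructure_one_comapEquiv_eq Ψ, HodgeStructure.comapEquiv_symm_comapEquiv]

/-- **`H¹(∏_k X_k, ℚ)` is polarisable as soon as every `H¹(X_k, ℚ)` is** (direct sums of polarisable Hodge structures
are polarisable, `IsPolarizable.pi`, transported). [cite: DeligneHodgeII1971, 2.1] -/
theorem isPolarizable_hodgeStructure_sigmaPiPeriod_one (h : ∀ k, (hodgeStructure (Ψ k) 1).IsPolarizable) :
    (hodgeStructure (sigmaPiPeriod Ψ) 1).IsPolarizable := by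
  rw [← pi_hodgeStructure_one_comapEquiv_eq Ψ]
  exact (HodgeStructure.IsPolarizable.pi h).comapEquiv _

end SigmaPi

/-! ## §4 `dim MT(H¹(∏_k X_k)) = dim MT(⊕_k H¹(X_k))` and the powers `Xⁿ` -/

section MumfordTateSigma

variable {κ : Type} [Fintype κ] [DecidableEq κ] {σ : κ → Type} [∀ k, Fintype (σ k)] [∀ k, DecidableEq (σ k)]
  {F : κ → Type} [∀ k, NormedAddCommGroup (F k)] [∀ k, NormedSpace ℂ (F k)]
  (Ψ : ∀ k, (σ k → ℝ) ≃L[ℝ] F k) [Literature.AlgebraicGeometry.Motives.HodgeTensorFacts.{0, 0}]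
  [Module.Finite ℚ (rationalForms (sigmaPiPeriod Ψ) 1)] [∀ k, Module.Finite ℚ (rationalForms (Ψ k) 1)]

/-- **`dim MT(H¹(∏_k X_k, ℚ)) = dim MT(⊕_k H¹(X_k, ℚ))`** — the Mumford–Tate group of the product torus is that of the
direct sum of the weight-one Hodge structures of the factors (`mtRank_comapEquiv` along `sigmaPiFormsEquiv`); universe-`0`
carriers (the tree's `HodgeTensorFacts.{0,0}` convention), finite-dimensionality as instance arguments
(`finiteDimensional_rationalForms`). [cite: Gordon1999HodgeAVSurvey, 2.15 (proof) and 2.1.7] [cite: DeligneHodgeII1971, 2.1] -/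
theorem mtRank_hodgeStructure_sigmaPiPeriod_one :
    (hodgeStructure (sigmaPiPeriod Ψ) 1).mtRank = (HodgeStructure.pi fun k => hodgeStructure (Ψ k) 1).mtRank := by
  rw [← pi_hodgeStructure_one_comapEquiv_eq Ψ, HodgeStructure.mtRank_comapEquiv]

end MumfordTateSigma

section MumfordTatePow

variable {ι : Type} [Fintype ι] [DecidableEq ι] {E : Type} [NormedAddCommGroup E] [NormedSpace ℂ E]
  (Φ : (ι → ℝ) ≃L[ℝ] E) (n : ℕ) [Literature.AlgebraicGeometry.Motives.HodgeTensorFacts.{0, 0}]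
  [Module.Finite ℚ (rationalForms (powPeriod Φ n) 1)]
  [Module.Finite ℚ (rationalForms (sigmaPiPeriod fun _ : Fin n => Φ) 1)] [Module.Finite ℚ (rationalForms Φ 1)]

/-- **`dim MT(H¹(Xⁿ, ℚ)) = dim MT(⊕_{j<n} H¹(X, ℚ))`** for the power torus `Xⁿ = ComplexTorus (powPeriod Φ n)` (`≅ ∏_{j<n} X`,
`isIsomorphic_powPeriod_sigmaPiPeriod_const`; the Mumford–Tate dimension is an isomorphism invariant, row g10-#1).  With the
diagonal action (Gordon Prop. 2.4) this is `dim MT(H¹(Xⁿ)) = dim MT(H¹(X))`; here the direct-sum form, which the CM files turn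
into numbers. [cite: Gordon1999HodgeAVSurvey, Prop. 2.4 and 2.15 (proof)] [cite: Lange2023AbelianVarietiesComplex, §2.4.4 Cor. 2.4.26] -/
theorem mtRank_hodgeStructure_powPeriod_one :
    (hodgeStructure (powPeriod Φ n) 1).mtRank = (HodgeStructure.pi fun _ : Fin n => hodgeStructure Φ 1).mtRank := by
  rw [IsIsomorphic.mtRank_hodgeStructure_eq (powPeriod Φ n) (sigmaPiPeriod fun _ : Fin n => Φ) (k := 1)
      (isIsomorphic_powPeriod_sigmaPiPeriod_const Φ n),
    mtRank_hodgeStructure_sigmaPiPeriod_one]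

end MumfordTatePow

end ComplexTorus

end Literature.Geometry.Kaehler

end
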